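import Literature.NumberTheory.EllipticCurves.ZpExtensionEisensteinAdicTowerIncReadoutProofs
import Literature.NumberTheory.EllipticCurves.IwasawaTwistedCocycleProofs
import HarnessLib

/-!
# The readout `H¹(K, A_𝔮) = colim_k H¹(K, T_𝔮/p^{k+1}T_𝔮) → H¹(K_∞, N)` of Howard's discrete module

Topic `NumberTheory/EllipticCurves` (sequel to `ZpExtensionEisensteinAdicTowerIncReadoutProofs` (the level readouts along
`H¹(inc)`), `Howard2004/DVRKolyvaginBound` (`AdicTower.H1A = DirectLimit`, `incH1LE`) and
`IwasawaEisensteinTwistedRepH1Transport{,Proofs}`; cell `pub/bsd-print-x9`, blueprint HOME/p2/S1-DISCRETE-CONTROL §1(d)).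
Definitions with bodies (`eisensteinTowerLevelMap`, `eisensteinTowerReadout`) and theorems; no named fact, no instance, no `sorry`.

For the shifted Eisenstein tower `T = κ.eisensteinAdicTowerSucc ρ t hm ht` (levels `M_{k+1} ⊗ A_{m,k+1}(χ_{k+1})`), a target
discrete module `N` with compatible equivariant maps `j_k : M_{k+1} → N` (for `E`: `E[p^{k+1}] ↪ E[p^∞]`):
* `eisensteinTowerLevelMap k = (-1)^k · (j_k)_* ∘ readout_{k+1} : H¹(K, T_k) →+ H¹(K_∞, N)`;
* `eisensteinTowerLevelMap_incH1`, `AdicTower.incH1LE_self/_succ`, `eisensteinTowerLevelMap_incH1LE`: these form a map of the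
  direct system `(H¹(K, T_k), H¹(inc))` (the sign absorbs `inc ∘ red = -p`);
* **`eisensteinTowerReadout : AdicTower.H1A T … →+ subgroupH1 κ₀.kerSubgroup N`** (`DirectLimit.lift`), `eisensteinTowerReadout_of`;
* **`psi_apply_eisensteinTowerReadout_eq_zero`**: its image is killed by `ψ_m = (conj_γ − 1)^m + p`;
* **`eq_zero_of_eisensteinTowerReadout_eq_zero`**: it is injective when the levels have no `Gal(K̄/K_∞)`-fixed vectors and the
  coefficient maps `(j_k)_* : H¹(K_∞, M_{k+1}) → H¹(K_∞, N)` are injective.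
This is Howard's map `H¹(K, A_𝔮) → H¹(K_∞, A)[𝔮]` (`𝔮 = (γ−1)^m + p`) on full `H¹`, before local conditions.

References: [Howard2004HeegnerKolyvagin] §1.6 (arXiv p. 12, L40–48), §2.2, Prop. 2.2.8 / proof of Thm. 2.2.10 and Prop. 3.2.8;
[GreenbergLNM1716] §4 pp. 107, 124.  BSD is not proved by any of this.
-/

noncomputable section

open Literature.NumberTheory.EllipticCurves Literature.NumberTheory.GaloisRepresentations Field
open Literature.NumberTheory.GaloisCohomology.Howard2004
open CategoryTheory ContinuousCohomology IwasawaAlgebra IwasawaAlgebra.EisensteinCoeff IwasawaAlgebra.EisensteinCoeff.TwistedBy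
open scoped ContRepresentation

/-! ### Unfolding `AdicTower.incH1LE` -/

namespace Literature.NumberTheory.GaloisCohomology.Howard2004.AdicTower

variable {K : Type} [Field K] [NumberField K] {R : Type} [CommRing R] [IsLocalRing R]
  {N : ℕ → Type} [∀ k, AddCommGroup (N k)] [∀ k, TopologicalSpace (N k)] [∀ k, DiscreteTopology (N k)] [∀ k, Module R (N k)]
  (T : AdicTower K R N) (π : R) (e : ℕ → ℕ)
  (hkill : ∀ k, ∀ r ∈ IsLocalRing.maximalIdeal R ^ e k, ∀ x : N k, r • x = 0)
  (hker : ∀ k, LinearMap.ker (T.red k) = (IsLocalRing.maximalIdeal R ^ e k) • (⊤ : Submodule R (N (k + 1))))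
  (hπ : π ∈ IsLocalRing.maximalIdeal R) (he : ∀ k, e k ≤ e (k + 1))

omit [NumberField K] in
/-- `incH1LE i i = id`. [cite: Howard2004HeegnerKolyvagin, §1.6 (arXiv p. 12, L40–48)] -/
theorem incH1LE_self (i : ℕ) (h : i ≤ i) : incH1LE T π e hkill hker hπ he i i h = AddMonoidHom.id _ :=
  Nat.leRec_self _ _

omit [NumberField K] in
/-- `incH1LE i (j+1) = incH1 j ∘ incH1LE i j`. [cite: Howard2004HeegnerKolyvagin, §1.6 (arXiv p. 12, L40–48)] -/
theorem incH1LE_succ (i j : ℕ) (h1 : i ≤ j) (h2 : i ≤ j + 1) :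
    incH1LE T π e hkill hker hπ he i (j + 1) h2 = (incH1 T π e hkill hker hπ he j).comp (incH1LE T π e hkill hker hπ he i j h1) :=
  Nat.leRec_succ _ _ h1

end Literature.NumberTheory.GaloisCohomology.Howard2004.AdicTower

namespace Literature.NumberTheory.EllipticCurves

namespace ZpExtension

variable {K : Type} [Field K] {p : ℕ} [hp : Fact p.Prime] (κ : ZpExtension K p)
  {M : ℕ → Type} [∀ k, AddCommGroup (M k)] [∀ k, TopologicalSpace (M k)] [∀ k, DiscreteTopology (M k)]
  [∀ k, DistribMulAction (absoluteGaloisGroup K) (M k)]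
  (ρ : ∀ k, DiscreteGaloisModule K (M k))
  (t : ∀ k, (ρ (k + 1)).toContRepresentation →ⁱL (ρ k).toContRepresentation)
  {m : ℕ} (hm : 1 ≤ m) (ht : ∀ k, Function.Surjective (t k)) (κ₀ : ZpExtension K p)
  (χ : ∀ k, absoluteGaloisGroup K →* EisensteinCoeff p m k)
  (hact : ∀ (k : ℕ) (σ : absoluteGaloisGroup K) (x : Twisted p m k (M k)),
    κ.eisensteinTwist (ρ k) hm k σ x = (ofTwisted (χ k) (M k)).symm (σ • ofTwisted (χ k) (M k) x))
  (hM : ∀ (k : ℕ) (a : M k), (p ^ k) • a = 0) (hχker : ∀ k, ∀ σ ∈ κ₀.kerSubgroup, χ k σ = 1)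
  {N : Type} [AddCommGroup N] [DistribMulAction (absoluteGaloisGroup K) N] [TopologicalSpace N] [DiscreteTopology N]
  (jN : ∀ k, M (k + 1) →+ N)
  (hjN : ∀ (k : ℕ) (x : κ₀.kerSubgroup) (a : M (k + 1)), jN k (ContinuousMonoidHom.id κ₀.kerSubgroup x • a) = x • jN k a)

/-- **The signed level map `(-1)^k · (j_k)_* ∘ readout_{k+1} : H¹(K, T_𝔮/p^{k+1}T_𝔮) →+ H¹(K_∞, N)`** (the sign makes the
family compatible with `H¹(inc)`, `inc ∘ red = -p`). [cite: Howard2004HeegnerKolyvagin, §1.6 (arXiv p. 12) and §2.2] -/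
def eisensteinTowerLevelMap (k : ℕ) :
    galoisCohomology (κ.eisensteinTwist (ρ (k + 1)) hm (k + 1)) 1 →+ subgroupH1 κ₀.kerSubgroup N :=
  ((-1 : ℤ) ^ k) • ((resH1Hom (ContinuousMonoidHom.id κ₀.kerSubgroup) (jN k) (hjN k)).comp
    (κ.eisensteinTwistLevelReadout hm (k + 1) (χ (k + 1)) (ρ (k + 1)) (hact (k + 1)) κ₀ (hM (k + 1)) (hχker (k + 1))))

/-- Unfolding `eisensteinTowerLevelMap`. [cite: Howard2004HeegnerKolyvagin, §2.2] -/
theorem eisensteinTowerLevelMap_apply (k : ℕ) (c : galoisCohomology (κ.eisensteinTwist (ρ (k + 1)) hm (k + 1)) 1) :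
    κ.eisensteinTowerLevelMap ρ hm κ₀ χ hact hM hχker jN hjN k c =
      ((-1 : ℤ) ^ k) • resH1Hom (ContinuousMonoidHom.id κ₀.kerSubgroup) (jN k) (hjN k)
        (κ.eisensteinTwistLevelReadout hm (k + 1) (χ (k + 1)) (ρ (k + 1)) (hact (k + 1)) κ₀ (hM (k + 1)) (hχker (k + 1)) c) :=
  rfl

variable (ι : ∀ k, M (k + 1) →+ M (k + 1 + 1))
  (hι' : ∀ (k : ℕ) (x : κ₀.kerSubgroup) (a : M (k + 1)), ι k (ContinuousMonoidHom.id κ₀.kerSubgroup x • a) = x • ι k a)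
  (hιt : ∀ (k : ℕ) (P : M (k + 1 + 1)), ι k (t (k + 1) P) = p • P)
  (hjι : ∀ (k : ℕ) (a : M (k + 1)), jN (k + 1) (ι k a) = jN k a)
  (π : IwasawaAlgebra p ⧸ Ideal.span {(PowerSeries.X ^ m + PowerSeries.C (p : ℤ_[p]) : IwasawaAlgebra p)})
  (e : ℕ → ℕ)
  -- the `IsLocalRing` structure of `S_m = Λ/(q_m)` is D1's `isLocalRing_quotient_X_pow_add_C p hm` (not an instance)
  (hkill : letI := IwasawaAlgebra.isLocalRing_quotient_X_pow_add_C p hm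
    ∀ k, ∀ r ∈ IsLocalRing.maximalIdeal (IwasawaAlgebra p ⧸ Ideal.span {(PowerSeries.X ^ m + PowerSeries.C (p : ℤ_[p]) : IwasawaAlgebra p)}) ^ e k, ∀ x : EisensteinLevel p m M (k + 1), r • x = 0)
  (hker : letI := IwasawaAlgebra.isLocalRing_quotient_X_pow_add_C p hm
    ∀ k, LinearMap.ker ((κ.eisensteinAdicTowerSucc ρ t hm ht).red k) =
      (IsLocalRing.maximalIdeal (IwasawaAlgebra p ⧸ Ideal.span {(PowerSeries.X ^ m + PowerSeries.C (p : ℤ_[p]) : IwasawaAlgebra p)}) ^ e k) • (⊤ : Submodule (IwasawaAlgebra p ⧸ Ideal.span {(PowerSeries.X ^ m + PowerSeries.C (p : ℤ_[p]) : IwasawaAlgebra p)}) (EisensteinLevel p m M (k + 1 + 1))))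
  (hπ : letI := IwasawaAlgebra.isLocalRing_quotient_X_pow_add_C p hm
    π ∈ IsLocalRing.maximalIdeal (IwasawaAlgebra p ⧸ Ideal.span {(PowerSeries.X ^ m + PowerSeries.C (p : ℤ_[p]) : IwasawaAlgebra p)})) (he : ∀ k, e k ≤ e (k + 1))
  (hπX : π = Ideal.Quotient.mk _ PowerSeries.X) (hek : ∀ k, e (k + 1) - e k = m)

include hι' hιt hjι hπX hek in
/-- **Compatibility with `H¹(inc)`**: `levelMap_{k+1} ∘ H¹(inc_k) = levelMap_k`.
[cite: Howard2004HeegnerKolyvagin, §1.6 (arXiv p. 12, L40–48) and §2.2, proof of Thm. 2.2.10] -/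
theorem eisensteinTowerLevelMap_incH1 (k : ℕ) :
    letI := IwasawaAlgebra.isLocalRing_quotient_X_pow_add_C p hm
    ∀ c : galoisCohomology ((κ.eisensteinAdicTowerSucc ρ t hm ht).ρ k) 1,
      κ.eisensteinTowerLevelMap ρ hm κ₀ χ hact hM hχker jN hjN (k + 1)
          (AdicTower.incH1 (κ.eisensteinAdicTowerSucc ρ t hm ht) π e hkill hker hπ he k c) =
        κ.eisensteinTowerLevelMap ρ hm κ₀ χ hact hM hχker jN hjN k c := by
  letI := IwasawaAlgebra.isLocalRing_quotient_X_pow_add_C p hm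
  intro c
  rw [eisensteinTowerLevelMap_apply, eisensteinTowerLevelMap_apply]
  have hB := κ.eisensteinTwistLevelReadout_incH1 ρ t hm ht κ₀ k (χ (k + 1)) (hact (k + 1)) (χ (k + 1 + 1))
    (hact (k + 1 + 1)) (hM (k + 1)) (hM (k + 1 + 1)) (hχker (k + 1)) (hχker (k + 1 + 1)) (ι k) (hι' k) (hιt k)
    π e hkill hker hπ he hπX (hek k) c
  rw [hB, map_neg]
  have hcomp : ∀ r : subgroupH1 κ₀.kerSubgroup (M (k + 1)),
      resH1Hom (ContinuousMonoidHom.id κ₀.kerSubgroup) (jN (k + 1)) (hjN (k + 1))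
          (resH1Hom (ContinuousMonoidHom.id κ₀.kerSubgroup) (ι k) (hι' k) r) =
        resH1Hom (ContinuousMonoidHom.id κ₀.kerSubgroup) (jN k) (hjN k) r := fun r ↦ by
    have h1 := congrArg (fun f : subgroupH1 κ₀.kerSubgroup (M (k + 1)) →+ subgroupH1 κ₀.kerSubgroup N ↦ f r)
      (resH1Hom_comp (ContinuousMonoidHom.id κ₀.kerSubgroup) (ι k) (hι' k) (ContinuousMonoidHom.id κ₀.kerSubgroup)
        (jN (k + 1)) (hjN (k + 1)))
    simp only [AddMonoidHom.comp_apply] at h1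
    rw [h1]
    exact congrArg (fun f : subgroupH1 κ₀.kerSubgroup (M (k + 1)) →+ subgroupH1 κ₀.kerSubgroup N ↦ f r)
      (resH1Hom_congr (ContinuousMonoidHom.ext fun _ ↦ rfl) (AddMonoidHom.ext fun a ↦ hjι k a) _ _)
  generalize κ.eisensteinTwistLevelReadout hm (k + 1) (χ (k + 1)) (ρ (k + 1)) (hact (k + 1)) κ₀ (hM (k + 1))
    (hχker (k + 1)) c = r
  rw [hcomp, pow_succ, mul_neg_one, neg_zsmul, zsmul_neg, neg_neg]

include hι' hιt hjι hπX hek in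
/-- **Compatibility with all transition maps `incH1LE`.** [cite: Howard2004HeegnerKolyvagin, §1.6 (arXiv p. 12, L40–48)] -/
theorem eisensteinTowerLevelMap_incH1LE (i j : ℕ) (hij : i ≤ j) :
    letI := IwasawaAlgebra.isLocalRing_quotient_X_pow_add_C p hm
    ∀ c : galoisCohomology ((κ.eisensteinAdicTowerSucc ρ t hm ht).ρ i) 1,
      κ.eisensteinTowerLevelMap ρ hm κ₀ χ hact hM hχker jN hjN j
          (AdicTower.incH1LE (κ.eisensteinAdicTowerSucc ρ t hm ht) π e hkill hker hπ he i j hij c) =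
        κ.eisensteinTowerLevelMap ρ hm κ₀ χ hact hM hχker jN hjN i c := by
  letI := IwasawaAlgebra.isLocalRing_quotient_X_pow_add_C p hm
  intro c
  induction hij with
  | refl => rw [AdicTower.incH1LE_self, AddMonoidHom.id_apply]
  | step hle ih =>
    rw [AdicTower.incH1LE_succ _ _ _ _ _ _ _ _ _ hle, AddMonoidHom.comp_apply,
      κ.eisensteinTowerLevelMap_incH1 ρ t hm ht κ₀ χ hact hM hχker jN hjN ι hι' hιt hjι π e hkill hker hπ he hπX hek, ih]

/-- **The readout `H¹(K, A_𝔮) →+ H¹(K_∞, N)`** of Howard's discrete module (`A_𝔮 = colim_k T_𝔮/p^{k+1}T_𝔮`,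
`AdicTower.H1A`): the `DirectLimit.lift` of the signed level maps.  For `E` (`N = E[p^∞]`): Howard's
`H¹(K, A_𝔮) → H¹(K_∞, E[p^∞])`, whose image lies in the `𝔮 = ((γ-1)^m + p)`-torsion.
[cite: Howard2004HeegnerKolyvagin, §2.2, proof of Thm. 2.2.10 and Prop. 3.2.8] [cite: GreenbergLNM1716, §4 p. 124] -/
def eisensteinTowerReadout :
    letI := IwasawaAlgebra.isLocalRing_quotient_X_pow_add_C p hm
    AdicTower.H1A (κ.eisensteinAdicTowerSucc ρ t hm ht) π e hkill hker hπ he →+ subgroupH1 κ₀.kerSubgroup N :=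
  letI := IwasawaAlgebra.isLocalRing_quotient_X_pow_add_C p hm
  AddCommGroup.DirectLimit.lift _ _ _ (fun k ↦ κ.eisensteinTowerLevelMap ρ hm κ₀ χ hact hM hχker jN hjN k)
    fun i j hij c ↦ κ.eisensteinTowerLevelMap_incH1LE ρ t hm ht κ₀ χ hact hM hχker jN hjN ι hι' hιt hjι π e hkill hker hπ
      he hπX hek i j hij c

/-- `eisensteinTowerReadout` on a class of level `k`. [cite: Howard2004HeegnerKolyvagin, §2.2] -/
theorem eisensteinTowerReadout_of (k : ℕ) :
    letI := IwasawaAlgebra.isLocalRing_quotient_X_pow_add_C p hm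
    ∀ c : galoisCohomology ((κ.eisensteinAdicTowerSucc ρ t hm ht).ρ k) 1,
      κ.eisensteinTowerReadout ρ t hm ht κ₀ χ hact hM hχker jN hjN ι hι' hιt hjι π e hkill hker hπ he hπX hek
          (AddCommGroup.DirectLimit.of _ _ k c) =
        κ.eisensteinTowerLevelMap ρ hm κ₀ χ hact hM hχker jN hjN k c :=
  fun _ ↦ AddCommGroup.DirectLimit.lift_of _ _ _ _ _

/-- An additive map intertwining `θ_A`, `θ_B` intertwines `(θ_A − 1)^n + q` and `(θ_B − 1)^n + q` (used for
`ψ_m = (conj_γ − 1)^m + p` and the coefficient maps `(j_k)_*`, which commute with conjugation). [cite: GreenbergLNM1716, §4 p. 124] -/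
theorem apply_psi_apply_of_comm {A B : Type} [AddCommGroup A] [AddCommGroup B] (F : A →+ B)
    (θA : AddMonoid.End A) (θB : AddMonoid.End B) (hF : ∀ a, F (θA a) = θB (F a)) (n q : ℕ) (a : A) :
    F (((θA - 1) ^ n + (q : AddMonoid.End A)) a) = ((θB - 1) ^ n + (q : AddMonoid.End B)) (F a) := by
  have hpow : ∀ (d : ℕ) (a : A), F (((θA - 1) ^ d) a) = ((θB - 1) ^ d) (F a) := by
    intro d
    induction d with
    | zero => intro a; rw [pow_zero, pow_zero, AddMonoid.End.one_apply, AddMonoid.End.one_apply]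
    | succ d ih =>
      intro a
      rw [pow_succ, pow_succ]
      change F (((θA - 1) ^ d) (θA a - a)) = ((θB - 1) ^ d) (θB (F a) - F a)
      rw [ih, map_sub, hF]
  change F (((θA - 1) ^ n) a + (q : AddMonoid.End A) a) = ((θB - 1) ^ n) (F a) + (q : AddMonoid.End B) (F a)
  rw [map_add, hpow, AddMonoid.End.natCast_apply, AddMonoid.End.natCast_apply, map_nsmul]

/-- **The image of `H¹(K, A_𝔮) → H¹(K_∞, N)` is killed by `ψ_m = (conj_γ − 1)^m + p`** (`γ` a topological generator with
`χ_k(γ)·(1+T) = 1` at every level; the `j_k` fully `Γ_K`-equivariant): Howard's «`H¹(K, A_𝔮) → H¹(K_∞, A)[𝔮]`».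
[cite: Howard2004HeegnerKolyvagin, §2.2, proof of Thm. 2.2.10 and Prop. 3.2.8] [cite: GreenbergLNM1716, §4 pp. 107, 124] -/
theorem psi_apply_eisensteinTowerReadout_eq_zero [κ₀.kerSubgroup.Normal] {γ : absoluteGaloisGroup K}
    (hχγ : ∀ k, χ k γ * EisensteinCoeff.onePlusT p m k = 1)
    (hjN' : ∀ (k : ℕ) (g : absoluteGaloisGroup K) (a : M (k + 1)), jN k (g • a) = g • jN k a)
    (θN : AddMonoid.End (subgroupH1 κ₀.kerSubgroup N)) (hθN : ∀ c, θN c = conjH1 κ₀.kerSubgroup N γ c) :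
    letI := IwasawaAlgebra.isLocalRing_quotient_X_pow_add_C p hm
    ∀ x : AdicTower.H1A (κ.eisensteinAdicTowerSucc ρ t hm ht) π e hkill hker hπ he,
    ((θN - 1) ^ m + (p : AddMonoid.End (subgroupH1 κ₀.kerSubgroup N)))
      (κ.eisensteinTowerReadout ρ t hm ht κ₀ χ hact hM hχker jN hjN ι hι' hιt hjι π e hkill hker hπ he hπX hek x) = 0 := by
  letI := IwasawaAlgebra.isLocalRing_quotient_X_pow_add_C p hm
  intro x
  induction x using AddCommGroup.DirectLimit.induction_on with
  | ih k c =>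
    rw [eisensteinTowerReadout_of, eisensteinTowerLevelMap_apply, map_zsmul,
      ← apply_psi_apply_of_comm (resH1Hom (ContinuousMonoidHom.id κ₀.kerSubgroup) (jN k) (hjN k))
        (conjH1 κ₀.kerSubgroup (M (k + 1)) γ : AddMonoid.End (subgroupH1 κ₀.kerSubgroup (M (k + 1)))) θN
        (fun a ↦ ((hθN _).trans (congrArg (fun f : subgroupH1 κ₀.kerSubgroup (M (k + 1)) →+ subgroupH1 κ₀.kerSubgroup N ↦ f a)
          (IwasawaDual.conjH1_comp_resH1Hom_id κ₀ (jN k) (hjN' k) (hjN k) γ))).symm) m p,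
      κ.psi_apply_eisensteinTwistLevelReadout_eq_zero hm (k + 1) (χ (k + 1)) (ρ (k + 1)) (hact (k + 1)) κ₀ (hM (k + 1))
        (hχker (k + 1)) (hχγ (k + 1)) _ (fun _ ↦ rfl), map_zero, zsmul_zero]

/-- **Injectivity of `H¹(K, A_𝔮) → H¹(K_∞, N)`** when the levels `M_k` have no `Gal(K̄/K_∞)`-fixed vectors and the coefficient
maps `(j_k)_* : H¹(K_∞, M_{k+1}) → H¹(K_∞, N)` are injective (for `E`: `E(K_∞)[p] = 0`).
[cite: Howard2004HeegnerKolyvagin, §2.2, proof of Thm. 2.2.10 and Lemma 3.2.9] [cite: GreenbergLNM1716, §4 p. 124] -/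
theorem eq_zero_of_eisensteinTowerReadout_eq_zero {γ : absoluteGaloisGroup K}
    (hχγ : ∀ k, χ k γ * EisensteinCoeff.onePlusT p m k = 1)
    (hfix : ∀ (k : ℕ) (a : M k), (∀ σ ∈ κ₀.kerSubgroup, σ • a = a) → a = 0)
    (hjinj : ∀ k, Function.Injective (resH1Hom (ContinuousMonoidHom.id κ₀.kerSubgroup) (jN k) (hjN k))) :
    letI := IwasawaAlgebra.isLocalRing_quotient_X_pow_add_C p hm
    ∀ x : AdicTower.H1A (κ.eisensteinAdicTowerSucc ρ t hm ht) π e hkill hker hπ he,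
      κ.eisensteinTowerReadout ρ t hm ht κ₀ χ hact hM hχker jN hjN ι hι' hιt hjι π e hkill hker hπ he hπX hek x = 0 →
        x = 0 := by
  letI := IwasawaAlgebra.isLocalRing_quotient_X_pow_add_C p hm
  intro x hx
  induction x using AddCommGroup.DirectLimit.induction_on with
  | ih k c =>
    rw [eisensteinTowerReadout_of, eisensteinTowerLevelMap_apply] at hx
    have h1 : resH1Hom (ContinuousMonoidHom.id κ₀.kerSubgroup) (jN k) (hjN k)
        (κ.eisensteinTwistLevelReadout hm (k + 1) (χ (k + 1)) (ρ (k + 1)) (hact (k + 1)) κ₀ (hM (k + 1)) (hχker (k + 1)) c) = 0 := by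
      have h2 := congrArg (fun y ↦ ((-1 : ℤ) ^ k) • y) hx
      simp only [← mul_zsmul, ← pow_add, Even.neg_one_pow ⟨k, rfl⟩, one_zsmul, zsmul_zero] at h2
      exact h2
    rw [← (resH1Hom (ContinuousMonoidHom.id κ₀.kerSubgroup) (jN k) (hjN k)).map_zero] at h1
    have h3 := κ.eq_zero_of_eisensteinTwistLevelReadout_eq_zero hm (k + 1) (χ (k + 1)) (ρ (k + 1)) (hact (k + 1)) κ₀ (hM (k + 1))
      (hχker (k + 1)) (hχγ (k + 1)) (hfix (k + 1)) c (hjinj k h1)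
    rw [h3]
    exact map_zero _

end ZpExtension

end Literature.NumberTheory.EllipticCurves
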